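import Literature.Analysis.OperatorTheory.Enflo2023.MinimalNorm
import Literature.Analysis.OperatorTheory.Enflo2023.RoomsSuffice
import Literature.Analysis.OperatorTheory.Enflo2023.CompactCase
import HarnessLib

/-!
# Enflo 2023: Part A ⟶ Part B, the type-1 branch end to end modulo its two displayed hypotheses

Source under adjudication: Per H. Enflo, *On the invariant subspace problem in Hilbert spaces*, arXiv:2305.15442 (v1
2023, v2 2024), bib key `Enflo2023` — a CLAIMED proof of the invariant subspace problem for operators on a separable
Hilbert space.  This file is part of the kernel-tight typing of the manuscript by the b2b-enflo repair cell
(formaliser 2, Part B: (28)–(47), the limiting argument and the final deduction).  It records what FOLLOWS (proved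
implications from the manuscript's displayed hypotheses) and, where a step does not follow, the typed inference
together with its refutation.  NOTHING here asserts that the manuscript's main theorem holds; no declaration concludes
the invariant subspace problem for an arbitrary operator.  Value (BLOCK-2b): theorems / refutations of typed
inferences about a text — not progress on the problem.

EnfloISP — Part B (formaliser 2).  END-TO-END COMPOSITION OF THE TYPE-1 BRANCH: Part A ⟶ (the gap) ⟶ Part B.

The announced theorem for operators of type 1 has, in the manuscript, exactly this architecture (v2 pp.2–5, 17–20):
  (A) for each n a MINIMAL move `ℓ'_n` (problem (1)) at a radius `ε_n ∈ [0.3, 0.7]` around `x₀`, `‖x₀‖ = 1`; the KKT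
      identity (5) and its consequence (9) `|⟨T^j ℓ'_n(T)y'_n, x₀ − ℓ'_n(T)y'_n⟩| ≤ (εθ)_n` for every `j`
      — PART A, theorems of formaliser 1 (`Literature.Analysis.OperatorTheory.Enflo2023.IsMinimal.kkt`, `.eq9'`, `.intertwine_pow`, `.opNorm_pow_le_one`,
      file `EnfloISP/PartA/MinimalNorm.lean`), stated over an abstract coefficient operator `V : E →L[ℂ] H`
      intertwined with `T` by a contraction `S` of `E` (`V ∘ S = T ∘ V`; in the paper `E = ℓ²`, `V = V_{y'}`, `S` = shift);
  (B) the Main Construction drives `(εθ)_n → 0` (Part A/B bookkeeping, first-order heuristics in the text);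
  (C) the outputs `ℓ'_n(T)y'_n = V_n a_n` converge IN NORM — the ROOM CLAIM of p.20, for which the text has no argument
      and whose typed form is refuted (`not_roomClaim`, `not_roomClaimFin`, files Gap.lean / GapFinite.lean);
  (D) the norm limit is non-cyclic by (11) and yields the invariant subspace — PART B (`LimitStep.lean`).
This file composes (A) + (B) + (C) ⟹ (D) in the kernel: `hasNontrivialClosedInvariantSubspace_of_minimal_sequence`
takes Part A's objects as data, (B) and (C) as the two hypotheses `hεθ`, `hconv`, and concludes.  The variant
`…_of_minimal_sequence_rooms` replaces (C) by the paper's intended mechanism (rooms `ρ_k → 0` from pivots), closed in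
Gap.lean.  So the whole type-1 branch is kernel-checked EXCEPT precisely the two displayed hypotheses, of which `hconv`
(resp. the rooms) is the located gap and `hεθ` rests on (27)/(33) (referee S14, formaliser 1).
STATUS: CLOSED (zero sorry).  Imports Part A (formaliser 1) read-only.
-/

open scoped InnerProductSpace
open Filter Topology

namespace Literature.Analysis.OperatorTheory.Enflo2023

variable {E H : Type*} [NormedAddCommGroup E] [InnerProductSpace ℂ E] [CompleteSpace E]
  [NormedAddCommGroup H] [InnerProductSpace ℂ H] [CompleteSpace H]

/-- Part A's (9) for every power of `T`: at a minimal move of radius `ε < ‖x₀‖`,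
`|⟨T^j Vℓ', x₀ − Vℓ'⟩| ≤ εθ = Re⟨Vℓ', x₀ − Vℓ'⟩` (`j ≥ 0`; uses (5) via `IsMinimal.kkt` and the intertwining
contraction `S`, `V ∘ S = T ∘ V`, through its powers). [cite: Enflo2023, v2 (5), (9), (11)] -/
theorem norm_inner_pow_le_etheta {V : E →L[ℂ] H} {x₀ : H} {ε : ℝ} {a : E}
    (h : IsMinimal V x₀ ε a) (hε : ε < ‖x₀‖)
    (S : E →L[ℂ] E) (hS : ‖S‖ ≤ 1) (T : H →L[ℂ] H) (hVS : ∀ b, V (S b) = T (V b)) (j : ℕ) :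
    ‖⟪x₀ - V a, (T ^ j) (V a)⟫_ℂ‖ ≤ (⟪x₀ - V a, V a⟫_ℂ).re := by
  obtain ⟨C, hC0, hC⟩ := h.kkt (h.ne_zero hε)
  exact IsMinimal.eq9' hC0 hC (S ^ j) (IsMinimal.opNorm_pow_le_one S hS j) (T ^ j)
    (IsMinimal.intertwine_pow S T hVS j)

/-- **The type-1 branch, end to end.**  Data: `T`; `‖x₀‖ = 1`; coefficient operators `V n : E →L[ℂ] H`
intertwined with `T` by one contraction `S` (`V n (S b) = T (V n b)`); radii `ε n ∈ [0.3, 0.7]`; minimal moves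
`a n` (Part A).  Hypotheses beyond Part A: `hεθ` — the Main Construction makes `(εθ)_n → 0`; `hconv` — the MC
outputs `V n (a n) = ℓ'_n(T)y'_n` converge in norm (THE ROOM CLAIM; refuted as an inference in Gap.lean).
Conclusion (Part B, (11)): `T` has a non-trivial closed invariant subspace. [cite: Enflo2023, v2 (5), (9), (11)] -/
theorem hasNontrivialClosedInvariantSubspace_of_minimal_sequence (T : H →L[ℂ] H) (x₀ : H) (hx₀ : ‖x₀‖ = 1)
    (V : ℕ → (E →L[ℂ] H)) (S : E →L[ℂ] E) (hS : ‖S‖ ≤ 1) (hVS : ∀ n b, V n (S b) = T (V n b))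
    (ε : ℕ → ℝ) (hε : ∀ n, (0.3 : ℝ) ≤ ε n ∧ ε n ≤ 0.7)
    (a : ℕ → E) (hmin : ∀ n, IsMinimal (V n) x₀ (ε n) (a n))
    (hεθ : Tendsto (fun n => (⟪x₀ - V n (a n), V n (a n)⟫_ℂ).re) atTop (𝓝 0))
    (w : H) (hconv : Tendsto (fun n => V n (a n)) atTop (𝓝 w)) :
    HasNontrivialClosedInvariantSubspace T := by
  have hlt : ∀ n, ε n < ‖x₀‖ := fun n => by rw [hx₀]; linarith [(hε n).2]
  have hdist : ∀ n, (0.3 : ℝ) ≤ ‖x₀ - V n (a n)‖ ∧ ‖x₀ - V n (a n)‖ ≤ 0.7 := fun n => by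
    rw [(hmin n).norm_sub_eq (hlt n)]; exact hε n
  exact hasNontrivialClosedInvariantSubspace_of_norm_convergent_MC T x₀ (fun n => V n (a n)) w
    (fun n => (⟪x₀ - V n (a n), V n (a n)⟫_ℂ).re) hx₀ hdist hconv hεθ
    (fun n j => norm_inner_pow_le_etheta (hmin n) (hlt n) S hS T (hVS n) j)

/-- The same with the norm convergence replaced by the paper's intended mechanism: ROOMS `ρ k → 0` for the
iterates `[ ]_n x₀ = x₀ − V n (a n)` from pivots `p k` on (v2 p.20: δ₂^40, δ₂^400, …).  Closed; the rooms are the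
unproved (and, as an inference from the text's facts, refuted) input. [cite: Enflo2023, v2 (5), (9), (11)] -/
theorem hasNontrivialClosedInvariantSubspace_of_minimal_sequence_rooms (T : H →L[ℂ] H) (x₀ : H)
    (hx₀ : ‖x₀‖ = 1)
    (V : ℕ → (E →L[ℂ] H)) (S : E →L[ℂ] E) (hS : ‖S‖ ≤ 1) (hVS : ∀ n b, V n (S b) = T (V n b))
    (ε : ℕ → ℝ) (hε : ∀ n, (0.3 : ℝ) ≤ ε n ∧ ε n ≤ 0.7)
    (a : ℕ → E) (hmin : ∀ n, IsMinimal (V n) x₀ (ε n) (a n))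
    (hεθ : Tendsto (fun n => (⟪x₀ - V n (a n), V n (a n)⟫_ℂ).re) atTop (𝓝 0))
    (p : ℕ → ℕ) (ρ : ℕ → ℝ)
    (hroom : ∀ k n, p k ≤ n → ‖(x₀ - V n (a n)) - (x₀ - V (p k) (a (p k)))‖ ≤ ρ k)
    (hρ : Tendsto ρ atTop (𝓝 0)) :
    HasNontrivialClosedInvariantSubspace T := by
  have hlt : ∀ n, ε n < ‖x₀‖ := fun n => by rw [hx₀]; linarith [(hε n).2]
  have hdist : ∀ n, (0.3 : ℝ) ≤ ‖x₀ - V n (a n)‖ ∧ ‖x₀ - V n (a n)‖ ≤ 0.7 := fun n => by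
    rw [(hmin n).norm_sub_eq (hlt n)]; exact hε n
  refine hasNontrivialClosedInvariantSubspace_of_rooms T x₀ hx₀ (fun n => x₀ - V n (a n))
    (fun n => (⟪x₀ - V n (a n), V n (a n)⟫_ℂ).re) hdist (fun n j => ?_) hεθ p ρ hroom hρ
  have := norm_inner_pow_le_etheta (hmin n) (hlt n) S hS T (hVS n) j
  simpa [sub_sub_cancel] using this

/-- For the record, the summable-steps form of the missing input (census R3): if the MC increments were
summable in norm the outputs would converge and the branch would close.  (Mathlib: summable distances ⇒ Cauchy.) [cite: Enflo2023, v2 (5), (9), (11)] -/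
theorem hasNontrivialClosedInvariantSubspace_of_minimal_sequence_summable (T : H →L[ℂ] H) (x₀ : H)
    (hx₀ : ‖x₀‖ = 1)
    (V : ℕ → (E →L[ℂ] H)) (S : E →L[ℂ] E) (hS : ‖S‖ ≤ 1) (hVS : ∀ n b, V n (S b) = T (V n b))
    (ε : ℕ → ℝ) (hε : ∀ n, (0.3 : ℝ) ≤ ε n ∧ ε n ≤ 0.7)
    (a : ℕ → E) (hmin : ∀ n, IsMinimal (V n) x₀ (ε n) (a n))
    (hεθ : Tendsto (fun n => (⟪x₀ - V n (a n), V n (a n)⟫_ℂ).re) atTop (𝓝 0))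
    (hsum : Summable fun n => ‖V (n + 1) (a (n + 1)) - V n (a n)‖) :
    HasNontrivialClosedInvariantSubspace T := by
  have hc : CauchySeq fun n => V n (a n) :=
    cauchySeq_of_summable_dist (by simpa [dist_eq_norm, norm_sub_rev] using hsum)
  obtain ⟨w, hw⟩ := cauchySeq_tendsto_of_complete hc
  exact hasNontrivialClosedInvariantSubspace_of_minimal_sequence T x₀ hx₀ V S hS hVS ε hε a hmin hεθ w hw

/-- **Compact class, end to end with NO convergence hypothesis.**  For `T` compact and injective, Part A's minimal
moves (`IsMinimal`, (5)/(9) via `kkt`/`eq9'`) at radii `ε n ∈ [0.3, 0.7]` together with the single Main-Construction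
output `(εθ)_n → 0` already give a non-trivial closed invariant subspace — the weak limit suffices
(`hasNontrivialClosedInvariantSubspace_of_isCompactOperator_MC`); neither the room claim nor norm convergence is used.
REPAIR-CENSUS entry "T compact", closed.  (The conclusion is classical — Aronszajn–Smith, Lomonosov
[cite: Lomonosov1973]; Ansari–Enflo [cite: AnsariEnflo1998] obtained it from NORM-convergent minimal vectors.)
[cite: Enflo2023, v2 (5), (9), (11)] -/
theorem hasNontrivialClosedInvariantSubspace_of_minimal_sequence_compact (T : H →L[ℂ] H)
    (hTc : IsCompactOperator T) (hT : Function.Injective T) (x₀ : H) (hx₀ : ‖x₀‖ = 1)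
    (V : ℕ → (E →L[ℂ] H)) (S : E →L[ℂ] E) (hS : ‖S‖ ≤ 1) (hVS : ∀ n b, V n (S b) = T (V n b))
    (ε : ℕ → ℝ) (hε : ∀ n, (0.3 : ℝ) ≤ ε n ∧ ε n ≤ 0.7)
    (a : ℕ → E) (hmin : ∀ n, IsMinimal (V n) x₀ (ε n) (a n))
    (hεθ : Tendsto (fun n => (⟪x₀ - V n (a n), V n (a n)⟫_ℂ).re) atTop (𝓝 0)) :
    HasNontrivialClosedInvariantSubspace T := by
  have hlt : ∀ n, ε n < ‖x₀‖ := fun n => by rw [hx₀]; linarith [(hε n).2]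
  have hdist : ∀ n, (0.3 : ℝ) ≤ ‖x₀ - V n (a n)‖ ∧ ‖x₀ - V n (a n)‖ ≤ 0.7 := fun n => by
    rw [(hmin n).norm_sub_eq (hlt n)]; exact hε n
  exact hasNontrivialClosedInvariantSubspace_of_isCompactOperator_MC T hTc hT x₀ hx₀ (fun n => V n (a n))
    (fun n => (⟪x₀ - V n (a n), V n (a n)⟫_ℂ).re) hdist hεθ
    (fun n j => norm_inner_pow_le_etheta (hmin n) (hlt n) S hS T (hVS n) j)

end Literature.Analysis.OperatorTheory.Enflo2023
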